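import Summits.MatrixMultiplication.MatrixMultiplication.Theses.OctonionicLaser
import Summits.MatrixMultiplication.MatrixMultiplication.Theorems.OctonionicLaserDefs
import Literature.Computability.AlgebraicComplexity.AsymptoticSpectrumDuality
import Literature.Computability.AlgebraicComplexity.StrassenSpectralTheorem
import Literature.Computability.AlgebraicComplexity.DegenerationSpectralMonotone
import Literature.Computability.AlgebraicComplexity.AsymptoticRankMatMul
import Literature.Barriers.MatrixMultiplication.RectangularBarrier
import Summits.MatrixMultiplication.MatrixMultiplication.Theorems.OctonionicLaserOctSpectralDominanceLaserSpectral
import HarnessLib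

/-!
# Route OctonionicLaser — crux `OctSpectralDominance` (stmt-MatrixMultiplication-7931): the asymptotic form

Crux (ii) of the route says: for every universal spectral point `F` of 3-tensors over `ℂ`,
`2 · F(⟨2,2,2⟩) ≤ F(t₈)` (`t₈ = octT ℂ`, the structure tensor of the complex octonions).  The route text
asserts that "by Strassen's spectral theorem this is the asymptotic degeneration `2 ⊙ ⟨2,2,2⟩ ≲ t₈`".
This file makes that sentence a kernel-checked equivalence, using the tree's proof of Strassen's
spectral theorem for Strassen-preordered semirings (`IsStrassenPreorder.asympLe_iff_forall_spectralPoint`,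
Zuiddam 2018 Thm. 2.12 = Strassen 1988 Thm. 2.4) on the semiring `T(ℂ)` of tensor classes modulo
restriction-equivalence (`TensorClass`, Strassen-preordered by restriction:
`TensorClass.isStrassenPreorder`), together with the dictionary between universal spectral points and
spectral points of `T(ℂ)` (`TensorClass.isSpectralPoint_eval`,
`TensorClass.isUniversalSpectralPoint_spectralMapOf`):

* `octSpectralDominance_iff_forall_isSpectralPoint` — (ii) ⟺ `φ(2·[⟨2,2,2⟩]) ≤ φ([t₈])` for every
  monotone semiring homomorphism `φ : T(ℂ) → ℝ`;
* `octSpectralDominance_iff_asympLe` — (ii) ⟺ `2·[⟨2,2,2⟩] ≲ [t₈]` in the asymptotic preorder of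
  `(T(ℂ), ≤)` (Zuiddam Def. 2.1);
* `octSpectralDominance_iff_subexp_restriction` — (ii) ⟺ there is a SUBEXPONENTIAL `f : ℕ → ℕ` with
  `(⟨2⟩ ⊗ ⟨2,2,2⟩)^{⊠N} ≤ ⟨f(N)⟩ ⊗ t₈^{⊠N}` (restriction!) for every `N` — the exact constructive content
  of the crux: the `N`-th Kronecker power of "two quaternion pairs" is a restriction of subexponentially
  many copies of the `N`-th Kronecker power of the octonions.

* `octSpectralDominance_of_blockFamily` — the practical sufficient form for constructions: if for every
  `ε > 0` some Kronecker power `t₈^{⊠k}` (`k ≥ 1`) DEGENERATES (over `ℂ[ε]`, `AlgDegeneratesTo`) to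
  `⟨m⟩ ⊗ ⟨2^j,2^j,2^j⟩` with `(2−ε)^k ≤ m` blocks of size `2^j`, `j ≥ (1−ε)k`, then (ii) holds
  (`m·F(⟨2,2,2⟩)^j ≤ F(t₈)^k` per level, then `ε → 0`).  The landed rate lemma `stub_blockRate` (p147863) is
  the special case of full-size blocks `j = k` at every level.

So a direct proof of (ii) is neither more nor less than such a restriction family; in particular no
single level suffices (the route's polystability remark), and the family may use `2^{o(N)}` auxiliary
diagonal copies but no extra octonion factors.  Everything is proved; no definitions, no named facts.

## References

* [Strassen1988] V. Strassen, *The asymptotic spectrum of tensors*, J. reine angew. Math. 384 (1988), Thm. 2.4, Thm. 3.8.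
* [Zuiddam2018] J. Zuiddam, PhD thesis (Amsterdam 2018), Def. 2.1, Thm. 2.12.
* [ChristandlVranaZuiddam2023] M. Christandl, P. Vrana, J. Zuiddam, J. AMS 36 (2023), §1.2, Prop. 1.6.
-/

noncomputable section

-- the tree's namespace `Summit.MatrixMultiplication.MatrixMultiplication.…` repeats a component by design
set_option linter.dupNamespace false

namespace Summit.MatrixMultiplication.MatrixMultiplication.Theorems

open Literature.Computability.AlgebraicComplexity
open Summit.MatrixMultiplication.MatrixMultiplication.Theses.OctonionicLaser (OctSpectralDominance)
open OctonionicLaser (octT)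

/-- The numeral `2` of `T(ℂ)` is the class of the diagonal tensor `⟨2⟩`. [folklore] -/
theorem tensorClass_two_eq_mk : (2 : TensorClass ℂ) = TensorClass.mk (unitTensor ℂ 2) := by
  rw [← TensorClass.natCast_eq_mk]
  norm_num

/-- **Crux (ii) ⟺ dominance at every spectral point of `T(ℂ)`**: `OctSpectralDominance` holds iff
`φ(2·[⟨2,2,2⟩]) ≤ φ([t₈])` for every `≤`-monotone semiring homomorphism `φ : T(ℂ) → ℝ`
(universal spectral points and spectral points of `T(ℂ)` correspond: CVZ 2023 §1.2). [cite: ChristandlVranaZuiddam2023, §1.2] -/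
theorem octSpectralDominance_iff_forall_isSpectralPoint :
    OctSpectralDominance ↔
      ∀ φ : TensorClass ℂ → ℝ, IsSpectralPoint (fun x y : TensorClass ℂ => x ≤ y) φ →
        φ (2 * TensorClass.mk (matMulTensor ℂ 2 2 2)) ≤ φ (TensorClass.mk (octT ℂ)) := by
  constructor
  · intro h φ hφ
    have hF := TensorClass.isUniversalSpectralPoint_spectralMapOf hφ
    have h2 : 2 * TensorClass.spectralMapOf φ (matMulTensor ℂ 2 2 2) ≤
        TensorClass.spectralMapOf φ (octT ℂ) := h _ hF
    rw [TensorClass.spectralMapOf_apply, TensorClass.spectralMapOf_apply] at h2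
    have hφ2 : φ (2 : TensorClass ℂ) = 2 := by exact_mod_cast hφ.map_natCast 2
    rwa [hφ.map_mul, hφ2]
  · intro h F hF
    have hφ := TensorClass.isSpectralPoint_eval hF
    have h2 := h _ hφ
    have hφ2 : TensorClass.eval F (2 : TensorClass ℂ) = 2 := by exact_mod_cast hφ.map_natCast 2
    rw [hφ.map_mul, hφ2, TensorClass.eval_mk hF, TensorClass.eval_mk hF] at h2
    exact h2

/-- **Crux (ii) ⟺ the asymptotic restriction `2·[⟨2,2,2⟩] ≲ [t₈]` in `(T(ℂ), ≤)`** (Strassen's spectral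
theorem, Zuiddam 2018 Thm. 2.12, applied to the Strassen-preordered semiring of tensor classes over `ℂ`).
[cite: Zuiddam2018, Thm. 2.12] -/
theorem octSpectralDominance_iff_asympLe :
    OctSpectralDominance ↔
      AsympLe (fun x y : TensorClass ℂ => x ≤ y) (2 * TensorClass.mk (matMulTensor ℂ 2 2 2))
        (TensorClass.mk (octT ℂ)) := by
  rw [octSpectralDominance_iff_forall_isSpectralPoint,
    (TensorClass.isStrassenPreorder ℂ).asympLe_iff_forall_spectralPoint]

/-- **Crux (ii) ⟺ a subexponential restriction family**: `OctSpectralDominance` holds iff there is a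
subexponential `f : ℕ → ℕ` (`∀ ε > 0 ∃ C ∀ N, f N ≤ C (1+ε)^N`) such that for every `N` the Kronecker power
`(⟨2⟩ ⊗ ⟨2,2,2⟩)^{⊠N}` is a RESTRICTION of `⟨f N⟩ ⊗ t₈^{⊠N}`.  This is the precise constructive content of the
crux (Zuiddam 2018 Def. 2.1 unfolded in coordinates). [cite: Zuiddam2018, Def. 2.1] -/
theorem octSpectralDominance_iff_subexp_restriction :
    OctSpectralDominance ↔
      ∃ f : ℕ → ℕ, IsSubexponential f ∧ ∀ N : ℕ,
        TensorRestrictsTo (kroneckerTensor (unitTensor ℂ (f N)) (kroneckerPow (octT ℂ) N))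
          (kroneckerPow (kroneckerTensor (unitTensor ℂ 2) (matMulTensor ℂ 2 2 2)) N) := by
  rw [octSpectralDominance_iff_asympLe]
  unfold AsympLe
  refine exists_congr fun f => and_congr Iff.rfl (forall_congr' fun N => ?_)
  rw [tensorClass_two_eq_mk, TensorClass.mk_mul_mk, TensorClass.mk_pow, TensorClass.mk_pow,
    TensorClass.natCast_eq_mk, TensorClass.mk_mul_mk]
  exact TensorClass.mk_le_mk_iff

/-- **Sufficient block-family form of crux (ii)** (for constructions): if for every `ε > 0` there are
`k ≥ 1`, `j`, `m` with `(2 − ε)^k ≤ m`, `(1 − ε)k ≤ j` and a degeneration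
`t₈^{⊠k} ⊵ ⟨m⟩ ⊗ ⟨2^j,2^j,2^j⟩`, then `2·F(⟨2,2,2⟩) ≤ F(t₈)` for every universal spectral point `F` over `ℂ`.
Per level: `m · F(⟨2,2,2⟩)^j ≤ m · F(⟨2^j,2^j,2^j⟩) ≤ F(t₈)^k` (degeneration-monotonicity of universal
spectral points, Strassen 1988 §3, in tree), hence `(2−ε)·F(⟨2,2,2⟩)^{1−ε} ≤ F(t₈)`; then `ε → 0⁺`.
[cite: Strassen1988, §3] -/
theorem octSpectralDominance_of_blockFamily
    (h : ∀ ε : ℝ, 0 < ε → ∃ k j m : ℕ, 1 ≤ k ∧ ((2 : ℝ) - ε) ^ k ≤ m ∧ (1 - ε) * k ≤ j ∧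
      AlgDegeneratesTo (kroneckerPow (octT ℂ) k)
        (kroneckerTensor (unitTensor ℂ m) (matMulTensor ℂ (2 ^ j) (2 ^ j) (2 ^ j)))) :
    OctSpectralDominance := by
  intro F hF
  -- `φ = F(⟨2,2,2⟩) ≥ 1`, `T = F(t₈) ≥ 0`
  have hφ1 : 1 ≤ F (matMulTensor ℂ 2 2 2) :=
    one_le_spectral_of_ne_zero hF (matMulTensor_ne_zero two_pos two_pos two_pos)
  have hφ0 : 0 < F (matMulTensor ℂ 2 2 2) := one_pos.trans_le hφ1
  have hT0 : 0 ≤ F (octT ℂ) := hF.nonneg _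
  -- per level: `(2 - ε) · φ^{1-ε} ≤ T`
  have key : ∀ ε : ℝ, 0 < ε → (2 - ε) * F (matMulTensor ℂ 2 2 2) ^ (1 - ε) ≤ F (octT ℂ) := by
    intro ε hε
    obtain ⟨k, j, m, hk, hm, hj, hd⟩ := h ε hε
    have h1 : F (kroneckerTensor (unitTensor ℂ m) (matMulTensor ℂ (2 ^ j) (2 ^ j) (2 ^ j))) ≤
        F (octT ℂ) ^ k := by
      rw [← hF.map_kroneckerPow (octT ℂ) k]
      exact hF.mono_of_algDegeneratesTo hd
    rw [hF.map_kronecker, hF.map_unitTensor] at h1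
    have h2 : F (matMulTensor ℂ 2 2 2) ^ j ≤ F (matMulTensor ℂ (2 ^ j) (2 ^ j) (2 ^ j)) := by
      rw [← hF.map_kroneckerPow (matMulTensor ℂ 2 2 2) j]
      exact hF.mono _ _ (tensorRestrictsTo_matMulTensor_pow_kroneckerPow ℂ 2 2 2 j)
    have h3 : F (matMulTensor ℂ 2 2 2) ^ ((1 - ε) * k) ≤ F (matMulTensor ℂ 2 2 2) ^ (j : ℝ) :=
      Real.rpow_le_rpow_of_exponent_le hφ1 hj
    rw [Real.rpow_natCast] at h3
    have h4 : ((2 - ε) * F (matMulTensor ℂ 2 2 2) ^ (1 - ε)) ^ k ≤ F (octT ℂ) ^ k := by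
      rw [mul_pow, ← Real.rpow_natCast (F (matMulTensor ℂ 2 2 2) ^ (1 - ε)) k,
        ← Real.rpow_mul hφ0.le]
      have hm0 : (0 : ℝ) ≤ m := Nat.cast_nonneg m
      calc (2 - ε) ^ k * F (matMulTensor ℂ 2 2 2) ^ ((1 - ε) * (k : ℝ))
          ≤ (m : ℝ) * F (matMulTensor ℂ 2 2 2) ^ j :=
            mul_le_mul hm h3 (Real.rpow_nonneg hφ0.le _) hm0
        _ ≤ (m : ℝ) * F (matMulTensor ℂ (2 ^ j) (2 ^ j) (2 ^ j)) := mul_le_mul_of_nonneg_left h2 hm0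
        _ ≤ F (octT ℂ) ^ k := h1
    exact le_of_pow_le_pow_left₀ (Nat.one_le_iff_ne_zero.mp hk) hT0 h4
  -- `ε → 0⁺`
  have hlim : Filter.Tendsto (fun ε : ℝ => (2 - ε) * F (matMulTensor ℂ 2 2 2) ^ (1 - ε))
      (nhdsWithin 0 (Set.Ioi 0)) (nhds (2 * F (matMulTensor ℂ 2 2 2))) := by
    have h2e : Filter.Tendsto (fun ε : ℝ => 2 - ε) (nhds 0) (nhds 2) := by
      simpa using (tendsto_const_nhds (x := (2 : ℝ))).sub (Filter.tendsto_id (x := nhds (0 : ℝ)))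
    have h1e : Filter.Tendsto (fun ε : ℝ => 1 - ε) (nhds 0) (nhds 1) := by
      simpa using (tendsto_const_nhds (x := (1 : ℝ))).sub (Filter.tendsto_id (x := nhds (0 : ℝ)))
    have hpow : Filter.Tendsto (fun ε : ℝ => F (matMulTensor ℂ 2 2 2) ^ (1 - ε)) (nhds 0)
        (nhds (F (matMulTensor ℂ 2 2 2) ^ (1 : ℝ))) :=
      (tendsto_const_nhds (x := F (matMulTensor ℂ 2 2 2))).rpow h1e (Or.inl hφ0.ne')
    rw [Real.rpow_one] at hpow
    exact (h2e.mul hpow).mono_left nhdsWithin_le_nhds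
  have hev : ∀ᶠ ε in nhdsWithin (0 : ℝ) (Set.Ioi 0),
      (2 - ε) * F (matMulTensor ℂ 2 2 2) ^ (1 - ε) ≤ F (octT ℂ) :=
    eventually_nhdsWithin_of_forall fun ε hε => key ε hε
  exact le_of_tendsto hlim hev

/-- **Stub `stub_octDominanceOfBlockFamily` of the crux skeleton of `OctSpectralDominance`
(stmt-MatrixMultiplication-7931, line `registered`)**: the block-family form ⟹ (ii), with the route's
inline terms (consequence stub; the block family itself is the open constructive content of the crux).
[cite: Strassen1988, §3] -/
theorem stub_octDominanceOfBlockFamily : (∀ ε : ℝ, 0 < ε → ∃ k j m : ℕ, 1 ≤ k ∧ ((2 : ℝ) - ε) ^ k ≤ m ∧ (1 - ε) * k ≤ j ∧ AlgDegeneratesTo (kroneckerPow (fun o p q : Fin 2 × Fin 2 × Fin 2 => (if o.1 = 0 ∧ p.1 = 0 ∧ q.1 = 0 then (Matrix.single p.2.1 p.2.2 (1:ℂ) * Matrix.single q.2.1 q.2.2 (1:ℂ)) o.2.1 o.2.2 else 0) - (if o.1 = 0 ∧ p.1 = 1 ∧ q.1 = 1 then ((Matrix.single q.2.1 q.2.2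 (1:ℂ)).adjugate * Matrix.single p.2.1 p.2.2 (1:ℂ)) o.2.1 o.2.2 else 0) + (if o.1 = 1 ∧ p.1 = 0 ∧ q.1 = 1 then (Matrix.single q.2.1 q.2.2 (1:ℂ) * Matrix.single p.2.1 p.2.2 (1:ℂ)) o.2.1 o.2.2 else 0) + (if o.1 = 1 ∧ p.1 = 1 ∧ q.1 = 0 then (Matrix.single p.2.1 p.2.2 (1:ℂ) * (Matrix.single q.2.1 q.2.2 (1:ℂ)).adjugate) o.2.1 o.2.2 else 0)) k) (kroneckerTensor (unitTensor ℂ m) (matMulTensor ℂ (2 ^ j) (2 ^ j) (2 ^ j)))) → ∀ F : SpectralMap ℂ, IsUniversalSpectralPoint ℂ F → 2 * F (matMulTensor ℂ 2 2 2) ≤ F (fun o p q : Fin 2 × Fin 2 × Fin 2 => (if o.1 = 0 ∧ p.1 = 0 ∧ q.1 = 0 then (Matrix.single p.2.1 p.2.2 (1:ℂ) * Matrix.single q.2.1 q.2.2 (1:ℂ)) o.2.1 o.2.2 else 0) - (if o.1 = 0 ∧ p.1 = 1 ∧ q.1 = 1 then ((Matrix.single q.2.1 q.2.2 (1:ℂ)).adjugate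 * Matrix.single p.2.1 p.2.2 (1:ℂ)) o.2.1 o.2.2 else 0) + (if o.1 = 1 ∧ p.1 = 0 ∧ q.1 = 1 then (Matrix.single q.2.1 q.2.2 (1:ℂ) * Matrix.single p.2.1 p.2.2 (1:ℂ)) o.2.1 o.2.2 else 0) + (if o.1 = 1 ∧ p.1 = 1 ∧ q.1 = 0 then (Matrix.single p.2.1 p.2.2 (1:ℂ) * (Matrix.single q.2.1 q.2.2 (1:ℂ)).adjugate) o.2.1 o.2.2 else 0)) :=
  octSpectralDominance_of_blockFamily

end Summit.MatrixMultiplication.MatrixMultiplication.Theorems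

end
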